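import Literature.MathematicalPhysics.QuantumFieldTheory.Balaban1983to89.Node00.LargeFieldTowerOfRecord
import Literature.MathematicalPhysics.QuantumFieldTheory.Balaban1983to89.Node00.LargeFieldTowerFactorizes

/-!
# NODE 00 — DEFINER ₇b support (typing hand `pub-ymgap-dag-n12-b`, dag-lead [REBALANCE-22] (α), announced [DAGN12B-G0-F4-DECLS]):
# the (1.1) WITNESS SHAPE for the TERM OF RECORD — `Factorizes11Loc (termOfSeq …)` from three displayed clauses

[IV] = [Balaban1989LargeFieldI] (CMP 122:175), (1.1) p. 177; [III] = [Balaban1988Convergent] (CMP 119:243), (2.17)–(2.19) p. 257,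
(2.22) p. 258.  DEFINER ₇'s FILE 5 `Node00.LargeFieldTowerOfRecord` (p414596) defines the term of an admissible sequence `termOfSeq`
on this seat's two-layer shape, with the piece `χ_k(s)·(𝐓_k e^{A_k})(s)` — `χ_k(s)` = r11's `chi218` at the record's pinned `LM₂R_k`-cube
family (`chiSeqOfRecord`), `(𝐓_k e^{A_k})(s)` the residual DATA `texpA`.

WHAT IS PROVED (theorems only; 0 `sorry`; no `instance`/`notation`).
* `piece_termOfSeq` (`rfl`) and `chiSeqOfRecord_eq_prod` — the χ-part IS the cube product of r11's `chi218_apply` at the pinned family: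
  `∏_{c ∈ cubesIn cube (s.Ω k)} χ({sup_{p ⊂ c^∼}|U_{k,c}(V, ∂p) − 1| < ε_kη²})`, each factor read through [15]'s minimizer `ukBox` on `c^{∼4}`.
* **`factorizes11Loc_termOfSeq`** — this seat's `factorizes11Loc_of_cubeProduct` INSTANTIATED at the term of record.  INPUTS, all
  DISPLAYED CLAUSES (none proved here; each a located reading): (L) LOCALITY of the cube factor — the factor of the cube `c` depends only
  on the bond variables `S c` ([15]'s determining-set property of the minimizer on `c^{∼4}`; [IV] (1.3) «for □ ⊂ (Ω_j^{∼4}∖Ω^∼_{j+1}) ∩ Z»);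
  (A) an ASSIGNMENT `comp` of cubes to the torus-touching components of `Z = Λ_kᶜ` (or to none) with `S c` inside that component's
  variables `compVars`, resp. inside `outVars` (the variables of `Z_k ∩ Zᶜ`); (T) the residual's (2.22) [III] clause
  `texpA p g k s = τ₀ · ∏_C τ_C`, `τ₀` on `outVars`, `τ_C` on `compVars C`.  OUTPUT: `Factorizes11Loc (termOfSeq F N ν τ texpA p g k s) outVars`.
HONEST FRAMING: instance of transport algebra; (L)/(A)/(T) are displayed clauses (GAPS rows: [15] determining sets; cube/component geometry;
(2.19)/(2.22) [III] on the actual 𝐓_k); nothing of Bałaban asserted; count-neutral; NOT continuum ∕ OS ∕ mass-gap ∕ Clay.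
-/

noncomputable section

open scoped BigOperators

namespace Literature.MathematicalPhysics.QuantumFieldTheory.Balaban1983to89.Node00

open T4Continuum B15DeterminingSets B14.Eq213DetSet B14.Eq216Concrete B14.Eq213MaximalDomains B15Eq112TorusCover B14DomainGeom
  B14.Eq218Concrete

variable (F : T4Family) (N : ℕ) [NeZero N]

/-- The piece of the term of record is `χ_k(s) · (𝐓_k e^{A_k})(s)` (`rfl`). [cite: Balaban1988Convergent, (2.18) p.257 (bookkeeping)] -/
theorem piece_termOfSeq (ν : Stage7Numerics) (τ : TowerNumerics) (texpA : TexpAOfRecord F N ν τ.M) (p : B12.RunParams)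
    (g : ℕ → ℝ) (k : ℕ) (s : SeqOfRecord F ν τ.M g p.K k) (V : GaugeField (F.P p.K) k (SU N)) :
    (termOfSeq F N ν τ texpA p g k s).piece V = chiSeqOfRecord F N ν τ.M g p.K k s V * texpA p g k s V := rfl

/-- `χ_k(s)` of record IS the cube product of (2.17)–(2.18) at the pinned `LM₂R_k`-cube family (r11's `chi218_apply`).
[cite: Balaban1988Convergent, (2.17)–(2.18) p.257] -/
theorem chiSeqOfRecord_eq_prod (ν : Stage7Numerics) (M : ℕ) (g : ℕ → ℝ) (K k : ℕ) (s : SeqOfRecord F ν M g K k)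
    (V : GaugeField (F.P K) k (SU N)) :
    chiSeqOfRecord F N ν M g K k s V =
      ∏ c ∈ cubesIn (fun a : ↥(cubeIndices (F.P K) (cubeSide (F.P K).L ν.M₂ (RkOfRecord (F.P K).L ν.r (g k)) k)) =>
          cubeEnl (F.P K) (cubeSide (F.P K).L ν.M₂ (RkOfRecord (F.P K).L ν.r (g k)) k) a 0) (s.Ω k),
        chiSmall (plaqInside (cubeEnl (F.P K) (cubeSide (F.P K).L ν.M₂ (RkOfRecord (F.P K).L ν.r (g k)) k) c 1))
          (epsOfRecord ν g k * (F.P K).eta k ^ 2)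
          (ukBox (bgOfRecord (avOfRecord F N K) {U | PlaqSmall (ν.εreg * (F.P K).eta k ^ 2) U}) ν.M₁
            (cubeEnl (F.P K) (cubeSide (F.P K).L ν.M₂ (RkOfRecord (F.P K).L ν.r (g k)) k) c 4) k V) := by
  rw [chiSeqOfRecord, chi218_apply]

open Classical in
/-- **The (1.1) witness shape for the term of record.**  From (L) the locality of each cube factor of `χ_k(s)` on a bond-variable set
`S c`, (A) an assignment of the cubes of `Ω_k` to the torus-touching components of `Z = Λ_kᶜ` (or to none) compatible with the
variable sets, and (T) the (2.22) [III] factorization clause on the residual `(𝐓_k e^{A_k})(s)`, the term `termOfSeq … s` satisfies the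
LOCALISED shape `Factorizes11Loc` with the untouched variables `outVars` — by `factorizes11Loc_of_cubeProduct`.
[cite: Balaban1989LargeFieldI, (1.1) p.177; Balaban1988Convergent, (2.17)–(2.19) p.257, (2.22) p.258] -/
theorem factorizes11Loc_termOfSeq (ν : Stage7Numerics) (τ : TowerNumerics) (texpA : TexpAOfRecord F N ν τ.M) (p : B12.RunParams)
    (g : ℕ → ℝ) (k : ℕ) (s : SeqOfRecord F ν τ.M g p.K k) (outVars : Set (PBond (F.P p.K) k))
    (S : ↥(cubeIndices (F.P p.K) (cubeSide (F.P p.K).L ν.M₂ (RkOfRecord (F.P p.K).L ν.r (g k)) k)) → Set (PBond (F.P p.K) k))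
    (hL : ∀ c, DependsOn (S c) fun V : GaugeField (F.P p.K) k (SU N) =>
      chiSmall (plaqInside (cubeEnl (F.P p.K) (cubeSide (F.P p.K).L ν.M₂ (RkOfRecord (F.P p.K).L ν.r (g k)) k) c 1))
        (epsOfRecord ν g k * (F.P p.K).eta k ^ 2)
        (ukBox (bgOfRecord (avOfRecord F N p.K) {U | PlaqSmall (ν.εreg * (F.P p.K).eta k ^ 2) U}) ν.M₁
          (cubeEnl (F.P p.K) (cubeSide (F.P p.K).L ν.M₂ (RkOfRecord (F.P p.K).L ν.r (g k)) k) c 4) k V))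
    (comp : ↥(cubeIndices (F.P p.K) (cubeSide (F.P p.K).L ν.M₂ (RkOfRecord (F.P p.K).L ν.r (g k)) k)) →
      Option (termOfSeq F N ν τ texpA p g k s).Comp)
    (hA : ∀ c i, comp c = some i → S c ⊆ (termOfSeq F N ν τ texpA p g k s).compVars i)
    (hA₀ : ∀ c, comp c = none → S c ⊆ outVars)
    (τ₀ : Density (F.P p.K) k (SU N)) (τc : (termOfSeq F N ν τ texpA p g k s).Comp → Density (F.P p.K) k (SU N))
    (hT : ∀ V, texpA p g k s V = τ₀ V *
      @Finset.prod _ ℝ _ (@Finset.univ _ (termOfSeq F N ν τ texpA p g k s).finComp) fun i => τc i V)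
    (hτ₀ : DependsOn outVars τ₀) (hτc : ∀ i, DependsOn ((termOfSeq F N ν τ texpA p g k s).compVars i) (τc i)) :
    Factorizes11Loc (termOfSeq F N ν τ texpA p g k s) outVars :=
  factorizes11Loc_of_cubeProduct (termOfSeq F N ν τ texpA p g k s)
    (cubesIn (fun a : ↥(cubeIndices (F.P p.K) (cubeSide (F.P p.K).L ν.M₂ (RkOfRecord (F.P p.K).L ν.r (g k)) k)) =>
      cubeEnl (F.P p.K) (cubeSide (F.P p.K).L ν.M₂ (RkOfRecord (F.P p.K).L ν.r (g k)) k) a 0) (s.Ω k))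
    _ S comp outVars (texpA p g k s) τ₀ τc
    (fun V => by rw [piece_termOfSeq, chiSeqOfRecord_eq_prod])
    (fun c _ => hL c) (fun c _ i h => hA c i h) (fun c _ h => hA₀ c h) hT hτ₀ hτc

end Literature.MathematicalPhysics.QuantumFieldTheory.Balaban1983to89.Node00

end
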